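import Summits.QuantumFields.YangMills.Theorems.BalabanUVNodesN16Thm4TorusOfZd
import Literature.MathematicalPhysics.QuantumFieldTheory.Balaban1983to89.B8TorusShiftLandau
import Literature.MathematicalPhysics.QuantumFieldTheory.Balaban1983to89.B7TranslationCovariance
import Literature.MathematicalPhysics.QuantumFieldTheory.Balaban1983to89.B8Eq131Derivation
import Literature.MathematicalPhysics.QuantumFieldTheory.Balaban1983to89.B8Thm2SetupTorus
import Literature.MathematicalPhysics.QuantumFieldTheory.Balaban1983to89.T3SectALandauChart
import HarnessLib

/-!
# Route «BalabanUVNodes», next to DAG node N16's periodicity principle — [B8] THEOREM 2 ON THE TORUS DESCENDS ALONG COVERS: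
# `Thm2TorusAt` AT PERIOD `P′` IMPLIES `Thm2TorusAt` AT EVERY PERIOD `P ∣ P′` WITH `Lᵏ ∣ P` (the symmetry argument of
# `BalabanUVNodesN16Thm4TorusOfZd.thm4TorusAt_of_period_zero`, for Theorem 2 instead of Theorem 4 and from a cover instead of from `ℤᵈ`),
# and the `T3Family` reading: a volume floor on a Theorem-2 supplier is no floor

Cell `pub/ym-inputs`, seat `ym-inputs-p06` gen 5 (I-08 row = the Theorem-2 socket of the EX knit), ONE def-free helper file worded BY NAME by
★★OWNER `ym3-torus-plan` g27 ACK 60 (1) (2026-08-28T12:51:20Z; desk `ym-inputs-plan-1` g12 WORD 1 (b)); `--supports stmt-QuantumFields-19200 --as helper`;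
`bears_on`: R3 ∕ `stmt-QuantumFields-19200` `stub_existenceMinimalOrbit` (EX), T2 socket (★★OWNER RULING g27-№2: displayed in `Thm2SetupSUAt`
currency), located floor LF-2VOL (ACK 55 (2), question (q2)).

WHY.  `B8Thm2TorusAt.Thm2TorusAt L k P η β₀ B₁ B₂ c₁ len G Reg` reads [Balaban1985RegularSpaces] Theorem 2 on the torus with `P` fine bonds per
direction as a statement about `P`-PERIODIC DATA ON `ℤᵈ`: its hypotheses (1.33) `InAk … U₀`, `Reg U₀`, (1.34) `InAk … (U′U₀)`, `InAx … (torusLam k)`,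
(1.35) `Hyp135 … (torusLam k)` do not mention `P`; `P` enters only through the periodicity of the data, of the gauge `u`, of the Lie-algebra field `A`
of the conclusion `Concl2T`, and through the class of competitors in the uniqueness clause.  Consequently the `m`-fold cover of that torus (`P′ = m·P`)
carries THE SAME `ℤᵈ` data, its deck transformations are the translations `t_{P·e_i}` (`B12Ineq417Flat.shiftCfg`), and Theorem 2 at period `P′`
yields Theorem 2 at period `P` by the argument of N16's file 2: a deck translate of the (unique) solution on the cover is again a solution, hence equal
to it, so the solution is `P`-periodic; its Lie-algebra field is `P`-periodic by the principal logarithm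
(`BalabanUVNodesN16Thm4TorusOfZd.periodic_of_mgauge_cfgExp`, regime `16·B₁·c₁ ≤ 1` from the (1.36)₁ sup member); and a `P`-periodic competitor is a
`P′`-periodic one.  The translation covariance of (1.29) and of every member of (1.36)–(1.39) is cell `lit-balaban`'s periodicity joint, BY NAME:
`B8TorusShiftAveraging.restr129_torusLam_shiftCfg`, `B8TorusShiftStencils.{covDerivFwd_shiftCfg, hquot_shiftCfg, admPair_shift_iff, cfgExp_shiftCfg',
covLap_shiftCfg, pdiv_plaqCovDeriv_shiftCfg}`, `B7TranslationCovariance.{mgauge_shiftCfg, logCovIter_shiftCfg}`, `B8TorusShiftLandau.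
isLandau138_torusLam_shiftCfg` (their `B8Thm2TorusPeriodic` runs the same symmetry argument INSIDE the supplier, at the `zdGF3` members; this file runs it
at the interface `Thm2TorusAt`, so that it composes with any supplier of the cover member).

USE (located, not asserted).  For the `T3Family` members of the EX knit's socket the `Lʲ`-fold cover of the member `(F, n, K)` is the member
`(⟨F.L, F.hL, F.m + j, _⟩, n, K)` (same `η = L^{−(K−n)}`, period `Lʲ·2L^{m+K}`; §4), so a supplier of `Thm2TorusAt` whose constants `(B₁, c₁)` are bound
before the member (as in `B8Thm2T3FamilyBinder.hThm2_of_constants`, one lemma upstream of its `thm2SetupSUAt_of_thm2TorusAt` step) and which carries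
a volume floor `k₀ ≤ F.m` serves every member; `B8Thm2SetupTorus.thm2SetupSUAt_of_thm2TorusAt` then reaches the displayed `Thm2SetupSUAt` socket.  What
this does NOT remove: the supplier's own per-member hypotheses, which are then read at the COVER member (period `L^{k₀}·P`, the same `ℤ³` field).

WHAT THIS FILE PROVES (kernel, theorems only, 0 `def`, 0 sorry):
§1 `shiftCfg_nsmul_eq`, `shiftCfg_zsmul_eq`, `shiftCfg_eq_of_dvd`, `periodic_of_dvd` — `v`-periodic data are periodic under integer multiples of `v`;
   `P`-periodic data are `P′`-periodic for `P ∣ P′`.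
§2 **`concl2T_shiftCfg`** — `Concl2T L k P′ … U₀ U′ u → Concl2T L k P′ … U₀ U′ (t_v u)` for `v = Lᵏ·a` with `t_vU₀ = U₀`, `t_vU′ = U′` (`L ≥ 1`), from
   lit-balaban's covariance letters; `concl2T_of_dvd` — `Concl2T … P … u → Concl2T … P′ … u` for `P ∣ P′`.
§3 **`thm2TorusAt_of_dvd_abstract`** (any `𝔸`, `G`, `Reg`): the descent GIVEN the `A`-periodicity upgrade as a hypothesis; `Thm2TorusAt.anti_c₁`
   (shrinking `c₁` is free — DISPLAYED: the regime below is met by shrinking the window, never by an estimate); **`concl2T_upgrade`** and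
   **`thm2TorusAt_of_dvd`** (`𝔸 = Matrix n n ℂ`, `G ≤ unitaryUnits`, `0 < η`, `0 ≤ B₁`, SIDE CONDITION `16·B₁·c₁ ≤ 1`, `1 ≤ L`, `(L:ℤ)^k ∣ P`, `P ∣ P′`):
   `Thm2TorusAt L k P′ η β₀ B₁ B₂ c₁ len G Reg → Thm2TorusAt L k P η β₀ B₁ B₂ c₁ len G Reg`; **`thm2TorusAt_of_dvd'`** (no side condition; conclusion at
   the window constant `min c₁ (16B₁)⁻¹`, `0 < B₁`).
§4 `sitesPerDir_zero_cover`, `eta_cover` (the `Lʲ`-fold cover of a `T3Family` member is the member of the family with volume exponent `m + j`);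
   **`thm2TorusAt_allMembers_of_floor`**, **`thm2SetupSUAt_allMembers_of_floor`** (the small member, in RULING g27-№2's currency), **`hThm2S_of_floor`**
   (literally the displayed socket `hThm2S`, from a floor-limited `Thm2TorusAt` supplier).
HONEST FRAMING: elementary symmetry bookkeeping by name; Theorem 2 itself is asserted for nothing (it stays a hypothesis everywhere); L-FLOOR none;
no summit ∕ sub-problem ∕ stub statement is proved; rung R3 bookkeeping, not T⁴, not Clay; YM gap NOT proved; count-neutral.
-/

set_option autoImplicit false

open scoped BigOperators Matrix Matrix.Norms.L2Operator
open NormedSpace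

namespace Summit.QuantumFields.YangMills.BalabanUVNodes.N16.Thm2TorusOfCover

open Literature.MathematicalPhysics.QuantumFieldTheory.Balaban1983to89
open B7Prop1Explicit B7Prop2Explicit
open B7Eq92Concrete (mgauge)
open B8Ineq132 (covDerivFwd InAk)
open B8Eq184Proof (cfgExp)
open B8Eq119TwistedAxial (Restr129 InAx)
open B8Eq133Hypotheses (Hyp135)
open B8Eq138LandauZd (covLap IsLandau138)
open B8Eq143PlaqExpansion (pdiv)
open B8Eq146AExpansion (iEta plaqCovDeriv)
open B7Prop4GeneralLevels (logCovIter)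
open B9Eq340HolderZd (hquot AdmPair)
open B8Thm4TorusAt (torusLam)
open B8Thm2TorusAt (C136T C137T C139T Concl2T Thm2TorusAt)
open B12Ineq417Flat (shiftCfg shiftCfg_apply shiftCfg_zero)
open B7TranslationCovariance (mgauge_shiftCfg logCovIter_shiftCfg)
open B8TorusShiftStencils (covDerivFwd_shiftCfg hquot_shiftCfg admPair_shift_iff cfgExp_shiftCfg' covLap_shiftCfg pdiv_plaqCovDeriv_shiftCfg)
open B8TorusShiftAveraging (restr129_torusLam_shiftCfg)
open B8TorusShiftLandau (isLandau138_torusLam_shiftCfg)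
open B8Eq131Derivation (mgauge_inv_mgauge)
open B7Prop2SpecialUnitary (specialUnitaryUnits specialUnitaryUnits_le_unitaryUnits)
open B8Thm2SetupTorus (Thm2SetupSUAt thm2SetupSUAt_of_thm2TorusAt pow_dvd_period)
open T3ContinuumYM3Torus (T3Family)
open T3SectALandauChart (eta eta_pos)

variable {d : ℕ}

/-! ## §1 Periods and their multiples -/

section Periods

variable {β : Type*}

/-- A `v`-periodic function on `ℤᵈ` is `n • v`-periodic for every natural `n`. [folklore] -/
theorem shiftCfg_nsmul_eq {v : Site d} {F : Site d → β} (h : shiftCfg v F = F) (n : ℕ) : shiftCfg (n • v) F = F := by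
  induction n with
  | zero => rw [zero_smul, shiftCfg_zero]
  | succ n ih =>
    funext x
    have h1 := congr_fun ih (x + v)
    have h2 := congr_fun h x
    rw [shiftCfg_apply] at h1 h2 ⊢
    rw [add_smul, one_smul, ← add_assoc, add_right_comm, h1, h2]

/-- A `v`-periodic function on `ℤᵈ` is `n • v`-periodic for every integer `n`. [folklore] -/
theorem shiftCfg_zsmul_eq {v : Site d} {F : Site d → β} (h : shiftCfg v F = F) (n : ℤ) : shiftCfg (n • v) F = F := by
  obtain ⟨m, rfl | rfl⟩ := Int.eq_nat_or_neg n
  · rw [natCast_zsmul]; exact shiftCfg_nsmul_eq h m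
  · have hm : shiftCfg ((m : ℤ) • v) F = F := by rw [natCast_zsmul]; exact shiftCfg_nsmul_eq h m
    funext x
    have := congr_fun hm (x + -((m : ℤ) • v))
    rw [shiftCfg_apply, neg_add_cancel_right] at this
    rw [shiftCfg_apply, neg_smul]
    exact this.symm

/-- `P`-periodic data (`t_{P·e_i}F = F`) are `P′`-periodic for `P ∣ P′`. [folklore] -/
theorem shiftCfg_eq_of_dvd {P P' : ℤ} (hPP' : P ∣ P') {F : Site d → β} (h : ∀ i : Fin d, shiftCfg (P • e i) F = F) (i : Fin d) :
    shiftCfg (P' • e i) F = F := by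
  obtain ⟨c, rfl⟩ := hPP'
  rw [mul_comm, mul_smul]
  exact shiftCfg_zsmul_eq (h i) c

/-- Pointwise form: `F (x + P·e_i) = F x` for all `x, i` gives `F (x + P′·e_i) = F x` for `P ∣ P′`. [folklore] -/
theorem periodic_of_dvd {P P' : ℤ} (hPP' : P ∣ P') {F : Site d → β} (h : ∀ (x : Site d) (i : Fin d), F (x + P • e i) = F x)
    (x : Site d) (i : Fin d) : F (x + P' • e i) = F x := by
  have h' : ∀ i : Fin d, shiftCfg (P • e i) F = F := fun i => funext fun y => h y i
  have := congr_fun (shiftCfg_eq_of_dvd hPP' h' i) x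
  rwa [shiftCfg_apply] at this

end Periods

/-! ## §2 The conclusion (1.36)–(1.39) of Theorem 2 under deck translations -/

section Conclusion

variable {𝔸 : Type*} [NormedRing 𝔸] [StarRing 𝔸] [NormedAlgebra ℂ 𝔸] [CompleteSpace 𝔸]

/-- **`Concl2T` IS COVARIANT UNDER TRANSLATING THE GAUGE BY A PERIOD OF THE DATA THAT IS A MULTIPLE OF `Lᵏ`.**  For `v = Lᵏ·a` with `t_vU₀ = U₀`,
`t_vU′ = U′`, and a period `P′` of the conclusion's Lie-algebra field: if `Concl2T L k P′ η β₀ B₁ B₂ len α₀ α₁ U₀ U′ u` holds with the field `A`, then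
it holds for the translated gauge `t_v u` with the translated field `t_v A` — (1.17) `mgauge`, `e^{iηA}`, (1.36)₁₂₃, (1.37), (1.38), (1.39)₁₂ are
all jointly translation covariant and the data are `v`-invariant (`L ≥ 1`). [cite: Balaban1985RegularSpaces, Thm 2 p.83, (1.36)–(1.38) p.82, (1.39) p.83, p.77 («Ω_j = T_η»)] -/
theorem concl2T_shiftCfg {L : ℕ} (hL : 1 ≤ L) {k : ℕ} {P' : ℤ} {η β₀ B₁ B₂ α₀ α₁ : ℝ} {len : Site d → ℝ}
    {U₀ U' : Site d → Fin d → 𝔸ˣ} {u : Site d → 𝔸ˣ} {a : Site d}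
    (hU₀ : shiftCfg (((L : ℤ) ^ k) • a) U₀ = U₀) (hU' : shiftCfg (((L : ℤ) ^ k) • a) U' = U')
    (h : Concl2T L k P' η β₀ B₁ B₂ len α₀ α₁ U₀ U' u) :
    Concl2T L k P' η β₀ B₁ B₂ len α₀ α₁ U₀ U' (shiftCfg (((L : ℤ) ^ k) • a) u) := by
  obtain ⟨A, hsa, hAP, hmg, ⟨h36a, h36b, h36c⟩, h37, h38, ⟨h39a, h39b⟩⟩ := h
  set v : Site d := ((L : ℤ) ^ k) • a with hv
  -- the covariant stencils of the translated field are the translated stencils (`U₀` is `v`-periodic)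
  have hD : ∀ (μ κ : Fin d) (x : Site d),
      covDerivFwd η U₀ μ (fun z => shiftCfg v A z κ) x = covDerivFwd η U₀ μ (fun z => A z κ) (x + v) := by
    intro μ κ x
    have e1 : (fun z => shiftCfg v A z κ) = shiftCfg v (fun z => A z κ) := rfl
    rw [e1]
    conv_lhs => rw [← hU₀]
    exact covDerivFwd_shiftCfg η v U₀ μ _ x
  have hΔ : ∀ (κ : Fin d) (x : Site d), covLap η U₀ (fun z => shiftCfg v A z κ) x = covLap η U₀ (fun z => A z κ) (x + v) := by
    intro κ x
    have e1 : (fun z => shiftCfg v A z κ) = shiftCfg v (fun z => A z κ) := rfl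
    rw [e1]
    conv_lhs => rw [← hU₀]
    exact covLap_shiftCfg η v U₀ _ x
  have h138' : IsLandau138 L k η (Set.univ : Set (Site d)) (torusLam k) U₀ (shiftCfg v A) := by
    have := isLandau138_torusLam_shiftCfg hL k η U₀ A a h38
    rwa [hU₀] at this
  refine ⟨shiftCfg v A, fun x μ => hsa (x + v) μ, fun x i μ => ?_, ?_, ⟨fun j hj x μ => ?_, fun j hj x μ κ => ?_, ?_⟩, fun x ν => ?_,
    h138', ⟨fun j hj x μ => ?_, fun j hj x κ => ?_⟩⟩
  · -- periodicity of `t_vA`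
    show A (x + P' • e i + v) μ = A (x + v) μ
    rw [add_right_comm]; exact hAP (x + v) i μ
  · -- `U′^{(t_v u)⁻¹} = e^{iη t_vA}`
    have hinv : (shiftCfg v u)⁻¹ = shiftCfg v u⁻¹ := rfl
    rw [hinv, cfgExp_shiftCfg', ← hmg]
    conv_lhs => rw [← hU₀, ← hU']
    exact mgauge_shiftCfg v U₀ u⁻¹ U'
  · exact h36a j hj (x + v) μ
  · rw [hD]; exact h36b j hj (x + v) μ κ
  · intro β hβ hββ₀ j hj μ κ q hq
    have hF : covDerivFwd η U₀ μ (fun z => shiftCfg v A z κ) = shiftCfg v (covDerivFwd η U₀ μ (fun z => A z κ)) :=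
      funext fun y => by rw [hD, shiftCfg_apply]
    have hQ : hquot η β len U₀ (shiftCfg v (covDerivFwd η U₀ μ (fun z => A z κ))) q
        = hquot η β len U₀ (covDerivFwd η U₀ μ (fun z => A z κ)) (q.1 + v, q.2 + v) := by
      have := hquot_shiftCfg η β len v U₀ (covDerivFwd η U₀ μ (fun z => A z κ)) q
      rwa [hU₀] at this
    rw [hF, hQ]
    exact h36c β hβ hββ₀ j hj μ κ (q.1 + v, q.2 + v) ((admPair_shift_iff η len v q).2 hq)
  · -- (1.37): `Q_k(U₀, iη t_vA)(x) = Q_k(U₀, iηA)(x + a')` with `v = Lᵏ·a`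
    have e1 : iEta η (shiftCfg v A) = shiftCfg v (iEta η A) := rfl
    rw [e1]
    have := logCovIter_shiftCfg L U₀ (iEta η A) k a x ν
    rw [hU₀] at this
    rw [← this]
    exact h37 (x + a) ν
  · have e1 := pdiv_plaqCovDeriv_shiftCfg η v U₀ A μ x
    rw [hU₀] at e1
    rw [e1]; exact h39a j hj (x + v) μ
  · rw [hΔ]; exact h39b j hj (x + v) κ

/-- A `P`-periodic Lie-algebra field is `P′`-periodic for `P ∣ P′`: `Concl2T L k P … u → Concl2T L k P′ … u` (the only occurrence of the period in
`Concl2T` is the periodicity clause of `A`). [cite: Balaban1985RegularSpaces, Thm 2 p.83] [folklore] -/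
theorem concl2T_of_dvd {L k : ℕ} {P P' : ℤ} (hPP' : P ∣ P') {η β₀ B₁ B₂ α₀ α₁ : ℝ} {len : Site d → ℝ}
    {U₀ U' : Site d → Fin d → 𝔸ˣ} {u : Site d → 𝔸ˣ} (h : Concl2T L k P η β₀ B₁ B₂ len α₀ α₁ U₀ U' u) :
    Concl2T L k P' η β₀ B₁ B₂ len α₀ α₁ U₀ U' u := by
  obtain ⟨A, hsa, hAP, hrest⟩ := h
  refine ⟨A, hsa, fun x i μ => ?_, hrest⟩
  have hAP' : ∀ (y : Site d) (j : Fin d), (fun z => A z μ) (y + P • e j) = (fun z => A z μ) y := fun y j => hAP y j μ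
  exact periodic_of_dvd (F := fun z => A z μ) hPP' hAP' x i

end Conclusion

/-! ## §3 The descent -/

section Abstract

variable {𝔸 : Type*} [NormedRing 𝔸] [StarRing 𝔸] [NormedAlgebra ℂ 𝔸] [CompleteSpace 𝔸]

/-- **DESCENT OF THEOREM 2 ALONG A COVER, ABSTRACT FORM** (any `𝔸`, any value group `G`, any regularity clause `Reg`).  Let `P ∣ P′` and `Lᵏ ∣ P`
(`L ≥ 1`), and suppose Theorem 2 holds at period `P′`: `Thm2TorusAt L k P′ η β₀ B₁ B₂ c₁ len G Reg`.  Suppose the UPGRADE: whenever `P`-periodic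
`G`-valued data `U₀, U′` in the window and a `P`-periodic `G`-valued gauge `u` satisfy `Concl2T L k P′ …` (Lie-algebra field `P′`-periodic), they
satisfy `Concl2T L k P …` (field `P`-periodic).  THEN `Thm2TorusAt L k P η β₀ B₁ B₂ c₁ len G Reg`: `P`-periodic data are `P′`-periodic, the unique
solution `u` at period `P′` has the solution `t_{P·e_i}u` as a competitor (§2), so `u` is `P`-periodic; and a `P`-periodic competitor at period
`P` is a competitor at period `P′`. [cite: Balaban1985RegularSpaces, Thm 2 p.83, p.77 («we admit the case where some domains Ω_j are equal to T_η»)] -/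
theorem thm2TorusAt_of_dvd_abstract {L : ℕ} (hL : 1 ≤ L) {k : ℕ} {P P' : ℤ} (hPP' : P ∣ P') (hkP : ((L : ℤ) ^ k) ∣ P)
    {η β₀ B₁ B₂ c₁ : ℝ} {len : Site d → ℝ} {G : Subgroup 𝔸ˣ} {Reg : (Site d → Fin d → 𝔸ˣ) → Prop}
    (hT : Thm2TorusAt L k P' η β₀ B₁ B₂ c₁ len G Reg)
    (hup : ∀ (α₀ α₁ : ℝ) (U₀ U' : Site d → Fin d → 𝔸ˣ) (u : Site d → 𝔸ˣ), 0 < α₀ → 0 < α₁ → α₀ + α₁ ≤ c₁ →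
      (∀ x κ, U₀ x κ ∈ G) → (∀ x κ, U' x κ ∈ G) → (∀ x, u x ∈ G) →
      (∀ i : Fin d, shiftCfg (P • e i) U₀ = U₀) → (∀ i : Fin d, shiftCfg (P • e i) U' = U') →
      (∀ (x : Site d) (i : Fin d), u (x + P • e i) = u x) →
      Concl2T L k P' η β₀ B₁ B₂ len α₀ α₁ U₀ U' u → Concl2T L k P η β₀ B₁ B₂ len α₀ α₁ U₀ U' u) :
    Thm2TorusAt L k P η β₀ B₁ B₂ c₁ len G Reg := by
  intro α₀ α₁ hα₀ hα₁ hc U₀ U' hU₀G hU'G hU₀P hU'P hA₀ hReg hA hAx h135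
  obtain ⟨c, hc'⟩ := hkP
  obtain ⟨u, ⟨huG, huP', hRes, hC⟩, huniq⟩ :=
    hT hα₀ hα₁ hc U₀ U' hU₀G hU'G (shiftCfg_eq_of_dvd hPP' hU₀P) (shiftCfg_eq_of_dvd hPP' hU'P) hA₀ hReg hA hAx h135
  -- a deck translate of the solution is a solution, hence equal to it: the gauge is `P`-periodic
  have hper : ∀ (x : Site d) (i : Fin d), u (x + P • e i) = u x := by
    intro x i
    have hv : P • e i = ((L : ℤ) ^ k) • (c • e i) := by rw [smul_smul, ← hc']
    have hU₀v : shiftCfg (((L : ℤ) ^ k) • (c • e i)) U₀ = U₀ := by rw [← hv]; exact hU₀P i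
    have hU'v : shiftCfg (((L : ℤ) ^ k) • (c • e i)) U' = U' := by rw [← hv]; exact hU'P i
    have hsol := huniq (shiftCfg (P • e i) u) (fun y => huG _)
      (fun y j => by rw [shiftCfg_apply, shiftCfg_apply, add_right_comm, huP'])
      (by rw [hv]; have := restr129_torusLam_shiftCfg L k U₀ u (c • e i) hRes; rwa [hU₀v] at this)
      (by rw [hv]; exact concl2T_shiftCfg hL hU₀v hU'v hC)
    have := congr_fun hsol x
    rwa [shiftCfg_apply] at this
  refine ⟨u, ⟨huG, hper, hRes, hup α₀ α₁ U₀ U' u hα₀ hα₁ hc hU₀G hU'G huG hU₀P hU'P hper hC⟩, ?_⟩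
  intro u' hu'G hu'P hRes' hC'
  exact huniq u' hu'G (periodic_of_dvd hPP' hu'P) hRes' (concl2T_of_dvd hPP' hC')

/-- Shrinking `c₁` is free: `Thm2TorusAt` is antitone in the window constant `c₁`. [cite: Balaban1985RegularSpaces, Thm 2 p.83] [folklore] -/
theorem Thm2TorusAt.anti_c₁ {L k : ℕ} {P : ℤ} {η β₀ B₁ B₂ c₁ c₁' : ℝ} {len : Site d → ℝ} {G : Subgroup 𝔸ˣ}
    {Reg : (Site d → Fin d → 𝔸ˣ) → Prop} (h : Thm2TorusAt L k P η β₀ B₁ B₂ c₁ len G Reg) (hc : c₁' ≤ c₁) :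
    Thm2TorusAt L k P η β₀ B₁ B₂ c₁' len G Reg :=
  fun _ _ hα₀ hα₁ hc' => h hα₀ hα₁ (hc'.trans hc)

end Abstract

section Concrete

variable {n : Type*} [Fintype n] [DecidableEq n]

/-- **ON PERIODIC UNITARY DATA THE LIE-ALGEBRA FIELD OF `Concl2T` IS PERIODIC** (the upgrade of §3's abstract form, discharged): for `P`-periodic
`U₀`, `U′`, `u` with values in `G ≤ unitaryUnits`, in the window `0 < α₀, α₁`, `α₀ + α₁ ≤ c₁`, with `0 < η`, `0 ≤ B₁`, `16·B₁·c₁ ≤ 1`: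
`Concl2T L k P′ … u → Concl2T L k P … u`.  The field `A` of `U′^{u⁻¹} = e^{iηA}` has `‖A‖ < B₁(α₀+α₁)η⁻¹` ((1.36)₁ at `j = 0`), so it is the bondwise
principal logarithm of the `P`-periodic unitary field `U′^{u⁻¹}` (`BalabanUVNodesN16Thm4TorusOfZd.periodic_of_mgauge_cfgExp`).
[cite: Balaban1985RegularSpaces, (1.36) p.82, p.89 («A₀ = (1/iη) log U′»), (1.3) p.77] -/
theorem concl2T_upgrade [Nonempty n] {L k : ℕ} {P P' : ℤ} {η β₀ B₁ B₂ c₁ α₀ α₁ : ℝ} (hη : 0 < η) (hB₁ : 0 ≤ B₁)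
    (hBc : 16 * (B₁ * c₁) ≤ 1) {len : Site d → ℝ} {G : Subgroup (Matrix n n ℂ)ˣ} (hG : G ≤ unitaryUnits (Matrix n n ℂ))
    {U₀ U' : Site d → Fin d → (Matrix n n ℂ)ˣ} {u : Site d → (Matrix n n ℂ)ˣ} (hα₀ : 0 < α₀) (hα₁ : 0 < α₁) (hc : α₀ + α₁ ≤ c₁)
    (hU₀G : ∀ x κ, U₀ x κ ∈ G) (hU'G : ∀ x κ, U' x κ ∈ G) (huG : ∀ x, u x ∈ G)
    (hU₀P : ∀ i : Fin d, shiftCfg (P • e i) U₀ = U₀) (hU'P : ∀ i : Fin d, shiftCfg (P • e i) U' = U')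
    (huP : ∀ (x : Site d) (i : Fin d), u (x + P • e i) = u x)
    (h : Concl2T L k P' η β₀ B₁ B₂ len α₀ α₁ U₀ U' u) : Concl2T L k P η β₀ B₁ B₂ len α₀ α₁ U₀ U' u := by
  obtain ⟨A, hsa, -, hmg, ⟨h36a, h36b, h36c⟩, h37, h38, h39⟩ := h
  refine ⟨A, hsa, fun x i μ => ?_, hmg, ⟨h36a, h36b, h36c⟩, h37, h38, h39⟩
  -- `U′ = (e^{iηA})^{u}` relative to `U₀`
  have hmg' : mgauge U₀ u (cfgExp η A) = U' := by
    rw [← hmg]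
    have := mgauge_inv_mgauge U₀ u⁻¹ U'
    rwa [inv_inv] at this
  -- the sup bound (1.36)₁ at `j = 0`: `‖A‖ ≤ (B₁η⁻¹)(α₀ + α₁)` with `(B₁η⁻¹)(α₀ + α₁)·η = B₁(α₀ + α₁) ≤ B₁c₁ ≤ 1/16`
  have hs : ∀ (x : Site d) (μ : Fin d), ‖A x μ‖ ≤ B₁ * η⁻¹ * (α₀ + α₁) := fun x μ => by
    have := h36a 0 (Nat.zero_le _) x μ
    rw [pow_zero, one_mul] at this
    have e : B₁ * (α₀ + α₁) * η⁻¹ = B₁ * η⁻¹ * (α₀ + α₁) := by ring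
    rw [← e]; exact this.le
  have hsmall : B₁ * η⁻¹ * (α₀ + α₁) * η ≤ 1 / 16 := by
    have e : B₁ * η⁻¹ * (α₀ + α₁) * η = B₁ * (α₀ + α₁) := by field_simp
    rw [e]
    have h1 : B₁ * (α₀ + α₁) ≤ B₁ * c₁ := mul_le_mul_of_nonneg_left hc hB₁
    linarith
  exact periodic_of_mgauge_cfgExp hη hsmall (fun x κ => hG (hU₀G x κ)) (fun x κ => hG (hU'G x κ)) (fun x => hG (huG x)) hU₀P hU'P huP
    hmg' hs x i μ

/-- **DESCENT OF THEOREM 2 ALONG A COVER.**  For unitary-matrix-valued data (`G ≤ unitaryUnits (Matrix n n ℂ)`), any regularity clause `Reg`,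
`0 < η`, `0 ≤ B₁`, the regime `16·B₁·c₁ ≤ 1`, `L ≥ 1`, `Lᵏ ∣ P` and `P ∣ P′`: Theorem 2 at period `P′` (the cover) implies Theorem 2 at period `P`
(the base), with the SAME constants `η, β₀, B₁, B₂, c₁, len`.  The abstract form with the upgrade `concl2T_upgrade`.
[cite: Balaban1985RegularSpaces, Thm 2 p.83, (1.29) p.81, (1.36)–(1.38) p.82, (1.39) p.83, p.77] -/
theorem thm2TorusAt_of_dvd [Nonempty n] {L : ℕ} (hL : 1 ≤ L) {k : ℕ} {P P' : ℤ} (hPP' : P ∣ P') (hkP : ((L : ℤ) ^ k) ∣ P)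
    {η β₀ B₁ B₂ c₁ : ℝ} (hη : 0 < η) (hB₁ : 0 ≤ B₁) (hBc : 16 * (B₁ * c₁) ≤ 1) {len : Site d → ℝ}
    {G : Subgroup (Matrix n n ℂ)ˣ} (hG : G ≤ unitaryUnits (Matrix n n ℂ)) {Reg : (Site d → Fin d → (Matrix n n ℂ)ˣ) → Prop}
    (hT : Thm2TorusAt L k P' η β₀ B₁ B₂ c₁ len G Reg) : Thm2TorusAt L k P η β₀ B₁ B₂ c₁ len G Reg :=
  thm2TorusAt_of_dvd_abstract hL hPP' hkP hT fun _ _ _ _ _ hα₀ hα₁ hc hU₀G hU'G huG hU₀P hU'P huP h =>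
    concl2T_upgrade hη hB₁ hBc hG hα₀ hα₁ hc hU₀G hU'G huG hU₀P hU'P huP h

/-- **DESCENT OF THEOREM 2 ALONG A COVER, REGIME-FREE FORM**: without the hypothesis `16·B₁·c₁ ≤ 1` the base statement holds at the window
constant `min c₁ (16B₁)⁻¹` (`0 < B₁`), which is all a consumer quantifying `∃ c₁ > 0` needs. [cite: Balaban1985RegularSpaces, Thm 2 p.83] -/
theorem thm2TorusAt_of_dvd' [Nonempty n] {L : ℕ} (hL : 1 ≤ L) {k : ℕ} {P P' : ℤ} (hPP' : P ∣ P') (hkP : ((L : ℤ) ^ k) ∣ P)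
    {η β₀ B₁ B₂ c₁ : ℝ} (hη : 0 < η) (hB₁ : 0 < B₁) {len : Site d → ℝ}
    {G : Subgroup (Matrix n n ℂ)ˣ} (hG : G ≤ unitaryUnits (Matrix n n ℂ)) {Reg : (Site d → Fin d → (Matrix n n ℂ)ˣ) → Prop}
    (hT : Thm2TorusAt L k P' η β₀ B₁ B₂ c₁ len G Reg) : Thm2TorusAt L k P η β₀ B₁ B₂ (min c₁ (16 * B₁)⁻¹) len G Reg := by
  refine thm2TorusAt_of_dvd hL hPP' hkP hη hB₁.le ?_ hG (Thm2TorusAt.anti_c₁ hT (min_le_left _ _))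
  calc 16 * (B₁ * min c₁ (16 * B₁)⁻¹) ≤ 16 * (B₁ * (16 * B₁)⁻¹) :=
        mul_le_mul_of_nonneg_left (mul_le_mul_of_nonneg_left (min_le_right _ _) hB₁.le) (by norm_num)
    _ = 1 := by field_simp

end Concrete

/-! ## §4 The `T3Family` members: the `Lʲ`-fold cover of a member is a member, and a floor on the volume exponent is no floor -/

section T3

/-- **THE `Lʲ`-FOLD COVER OF A MEMBER IS A MEMBER**: the family `⟨L, hL, m + j, _⟩` has, at run `K` and height `0`, `Lʲ` times as many fine sites per
direction as `⟨L, hL, m, _⟩` (`2L^{m+j+K} = Lʲ·2L^{m+K}`, `Setup.sitesPerDir`). [cite: Balaban1985UV3, (1)-(3) p.256; Balaban1987RG1, (0.1) p.251] -/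
theorem sitesPerDir_zero_cover (F : T3Family) (j K : ℕ) :
    ((⟨F.L, F.hL, F.m + j, le_add_right F.hm⟩ : T3Family).P K).sitesPerDir 0 = F.L ^ j * (F.P K).sitesPerDir 0 := by
  show 2 * F.L ^ (F.m + j + K - 0) = F.L ^ j * (2 * F.L ^ (F.m + K - 0))
  rw [Nat.sub_zero, Nat.sub_zero, show F.m + j + K = j + (F.m + K) by omega, pow_add]
  ring

/-- The spacing `η = L^{−(K−n)}` of a member does not see the volume exponent: it is the same for the cover family (definitional).
[cite: Balaban1985Variational, (2) and (5) p.278] -/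
theorem eta_cover (F : T3Family) (j n K : ℕ) : eta (⟨F.L, F.hL, F.m + j, le_add_right F.hm⟩ : T3Family) n K = eta F n K := rfl

/-- **A VOLUME FLOOR ON THE THEOREM-2 SOCKET IS NO FLOOR (`Thm2TorusAt` currency).**  If a supplier delivers, with ONE pair `(B₁, c₁)`, `0 < B₁`,
Theorem 2 in the shape `∃ β₀ B₂ len, Thm2TorusAt (F.P K).L (K − n) (sitesPerDir 0) (eta F n K) β₀ B₁ B₂ c₁ len SU(2) ⊤` for every member `(F, n, K)`,
`n < K`, of block size `L` ABOVE a volume floor `k₀ ≤ F.m`, then the same holds for EVERY member, at the window constant `min c₁ (16B₁)⁻¹`: the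
member `(F, n, K)` is served by its `L^{k₀}`-fold cover `(⟨L, hL, F.m + k₀, _⟩, n, K)` through `thm2TorusAt_of_dvd'` (`P = 2L^{m+K} ∣ L^{k₀}·P`,
`L^{K−n} ∣ P` by `B8Thm2SetupTorus.pow_dvd_period`). [cite: Balaban1985RegularSpaces, Thm 2 p.83, p.77] -/
theorem thm2TorusAt_allMembers_of_floor {L : ℕ} {B₁ c₁ : ℝ} (hB₁ : 0 < B₁) (k₀ : ℕ)
    (h : ∀ F : T3Family, F.L = L → k₀ ≤ F.m → ∀ (n K : ℕ), n < K →
      ∃ (β₀ B₂ : ℝ) (len : Site (F.P K).d → ℝ),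
        Thm2TorusAt (F.P K).L (K - n) ((((F.P K).sitesPerDir 0 : ℕ) : ℤ)) (eta F n K) β₀ B₁ B₂ c₁ len (specialUnitaryUnits (Fin 2))
          (fun _ => True))
    (F : T3Family) (hF : F.L = L) {n K : ℕ} (hnK : n < K) :
    ∃ (β₀ B₂ : ℝ) (len : Site (F.P K).d → ℝ),
      Thm2TorusAt (F.P K).L (K - n) ((((F.P K).sitesPerDir 0 : ℕ) : ℤ)) (eta F n K) β₀ B₁ B₂ (min c₁ (16 * B₁)⁻¹) len
        (specialUnitaryUnits (Fin 2)) (fun _ => True) := by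
  obtain ⟨β₀, B₂, len, hT⟩ := h ⟨F.L, F.hL, F.m + k₀, le_add_right F.hm⟩ hF (Nat.le_add_left _ _) n K hnK
  refine ⟨β₀, B₂, len, thm2TorusAt_of_dvd' (le_of_lt F.hL.2) ?_ ?_ (eta_pos F n K) hB₁ specialUnitaryUnits_le_unitaryUnits hT⟩
  · rw [sitesPerDir_zero_cover, Nat.cast_mul]
    exact Dvd.intro_left _ rfl
  · exact pow_dvd_period (F.P K) (by show K - n ≤ F.m + K - 0; omega)

/-- **… AND IN THE `Thm2SetupSUAt` CURRENCY OF THE EX KNIT'S DISPLAYED SOCKET** (★★OWNER ym3-torus-plan RULING g27-№2): from the same floor-limited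
`Thm2TorusAt` supplier, `∃ β₀ B₂ len, Thm2SetupSUAt (F.P K) 2 (K − n) (eta F n K) β₀ B₁ B₂ (min c₁ (16B₁)⁻¹) len ⊤` for EVERY member — §5's
all-members statement followed by `B8Thm2SetupTorus.thm2SetupSUAt_of_thm2TorusAt`.  (The socket quantifies `∃ B₁ c₁ > 0` before the members, so the
shrunken window constant is immaterial to it.) [cite: Balaban1985RegularSpaces, Thm 2 p.83, p.77] -/
theorem thm2SetupSUAt_allMembers_of_floor {L : ℕ} {B₁ c₁ : ℝ} (hB₁ : 0 < B₁) (k₀ : ℕ)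
    (h : ∀ F : T3Family, F.L = L → k₀ ≤ F.m → ∀ (n K : ℕ), n < K →
      ∃ (β₀ B₂ : ℝ) (len : Site (F.P K).d → ℝ),
        Thm2TorusAt (F.P K).L (K - n) ((((F.P K).sitesPerDir 0 : ℕ) : ℤ)) (eta F n K) β₀ B₁ B₂ c₁ len (specialUnitaryUnits (Fin 2))
          (fun _ => True))
    (F : T3Family) (hF : F.L = L) {n K : ℕ} (hnK : n < K) :
    ∃ (β₀ B₂ : ℝ) (len : Site (F.P K).d → ℝ),
      Thm2SetupSUAt (F.P K) 2 (K - n) (eta F n K) β₀ B₁ B₂ (min c₁ (16 * B₁)⁻¹) len (fun _ => True) := by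
  obtain ⟨β₀, B₂, len, hT⟩ := thm2TorusAt_allMembers_of_floor hB₁ k₀ h F hF hnK
  exact ⟨β₀, B₂, len, thm2SetupSUAt_of_thm2TorusAt hT⟩

/-- **SOCKET SHAPE.**  The EX knit's Theorem-2 socket in `Thm2SetupSUAt` currency (`hThm2S` of RULING g27-№2, all members, `∃ B₁ c₁ > 0` first) from a
`Thm2TorusAt`-currency supplier that is allowed a volume floor `k₀ ≤ F.m` per block size `L`. [cite: Balaban1985RegularSpaces, Thm 2 p.83, p.77] -/
theorem hThm2S_of_floor
    (h : ∀ (L : ℕ), 1 < L → ∃ (k₀ : ℕ) (B₁ c₁ : ℝ), 0 < B₁ ∧ 0 < c₁ ∧ ∀ F : T3Family, F.L = L → k₀ ≤ F.m → ∀ (n K : ℕ), n < K →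
      ∃ (β₀ B₂ : ℝ) (len : Site (F.P K).d → ℝ),
        Thm2TorusAt (F.P K).L (K - n) ((((F.P K).sitesPerDir 0 : ℕ) : ℤ)) (eta F n K) β₀ B₁ B₂ c₁ len (specialUnitaryUnits (Fin 2))
          (fun _ => True)) :
    ∀ (L : ℕ), 1 < L → ∃ B₁ c₁ : ℝ, 0 < B₁ ∧ 0 < c₁ ∧ ∀ F : T3Family, F.L = L → ∀ (n K : ℕ), n < K →
      ∃ (β₀ B₂ : ℝ) (len : Site (F.P K).d → ℝ),
        Thm2SetupSUAt (F.P K) 2 (K - n) (eta F n K) β₀ B₁ B₂ c₁ len (fun _ => True) := by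
  intro L hL
  obtain ⟨k₀, B₁, c₁, hB₁, hc₁, hS⟩ := h L hL
  exact ⟨B₁, min c₁ (16 * B₁)⁻¹, hB₁, lt_min hc₁ (by positivity), fun F hF n K hnK =>
    thm2SetupSUAt_allMembers_of_floor hB₁ k₀ hS F hF hnK⟩

end T3

end Summit.QuantumFields.YangMills.BalabanUVNodes.N16.Thm2TorusOfCover
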